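import Mathlib.Tactic.DeriveFintype
import Literature.Computability.Cryptography.Subexponential
import Literature.Computability.Complexity.TM2ToStackProgram
import HarnessLib

/-!
# `SE` is closed under SERF reductions (discharge of `mem_SE_of_serfReducible`)

Sibling proof file of `Subexponential.lean` (D-0014). It discharges

* `Literature.Computability.Cryptography.mem_SE_of_serfReducible_holds : mem_SE_of_serfReducible`
  — if `Q₁` SERF-reduces to `Q₂` and `Q₂ ∈ SE` then `Q₁ ∈ SE` (Impagliazzo–Paturi–Zane).

Printed proof (IPZ, FOCS 1998 version, Lemma 9, p. 7; JCSS 2001, §2.1): given `ε > 0`, take a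
member `M` of the SERF family with a smaller exponent, the constant `C` with `p₂(q) ≤ C p₁(x)`
for its queries, and a decider `N₂` of `Q₂` with exponent `≈ ε / C`; simulating `M` and answering
each query by running `N₂` decides `Q₁` in time `poly(|x|) 2^{ε p₁(x)}`.

Formalisation (no Turing machine is programmed). The simulation is a genuine *while loop* —
run the step machine of `M` on `(x, answers so far)`; on a query `q` run the decider of `Q₂` on
`q` and append its answer bit; on an output, stop — so no clock and no computability of the
complexity parameter is needed: the running time is bounded a priori by
`fuel(x) × (step time + decider time + bookkeeping)`. The machine is assembled from the tree's
toolkit: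

* `TM2Flat.exists_runs_of_outputsWithin` (`TM2ToStackProgram.lean`): the two black-box machines
  (the step machine of the reduction and the decider of `Q₂`, both `TM2ComputableAux Bool Bool`)
  are structured binary stack programs (`ACom Bool (TM2Flat.Reg nK)`, `SymbolPrograms.lean`)
  with linear overhead `e (m + |l| + |l'|) + e`;
* the program algebra of `SymbolPrograms.lean` (`Runs.seq/loop/pop/inl/inr`, `pour`, `copy2`,
  `clear`) for the bookkeeping: the registers hold the reversed input `x`, the unary counter
  `1^{2k}` and the reversed *body* `b₁b₁01 … b_kb_k01` of the `listBool` code of the answer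
  transcript, from which the step-machine input `boolPair x (listBool-code of the answers)` is
  rebuilt every round (`SerfSim.runs_buildInput`);
* `ACom.exists_computesInTime`: the program, with its exact cost semantics, is a `TM2` machine.

The cost bookkeeping is done first in `ℕ` (`SerfSim.runs_simMain`, `SerfSim.total_le`), then in
`ℝ` with the closure of bounds `c · 2^{κ p(x)} · (|x|+1)^c` under sums and products
(`SerfSim.Gb`, `SerfSim.isSubexpTimeBound_ttot`), with exponents `ε/3` for the reduction and
`ε/(3(C+1))` for the decider of `Q₂` (`C` = the SERF constant bounding the parameters of the
queries), so that `fuel · (step time) ≲ 2^{(ε/3)p} · 2^{(2ε/3)p}`.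

## References

* R. Impagliazzo, R. Paturi, F. Zane, *Which problems have strongly exponential complexity?*,
  J. Comput. System Sci. 63 (2001) 512–530, §2.1; FOCS 1998 version
  (doi:10.1109/sfcs.1998.743516), p. 2 (SE, SERF) and Lemma 9, p. 7 (SE is closed under SERF
  reductions), with its printed proof.
* S. Arora, B. Barak, *Computational Complexity: A Modern Approach*, CUP 2009, §1.3–1.4
  (machine simulations), §3.4 (oracle machines).
-/

namespace Literature.Computability.Cryptography

open _root_.Computability Turing Complexity

namespace SerfSim

open Complexity.ACom Complexity.TM2Flat

/-! ### Registers and stores -/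

/-- The bookkeeping registers of the simulation: `xr` (the input, reversed), `kr` (the unary
counter `1^{2k}`, `k` = number of answers so far), `br` (the body of the transcript code,
reversed), `tmp` (scratch; also the input register of the compiled machine), `f` (the loop
flag) and `out` (the output register). [folklore] -/
inductive Rg
  | xr | kr | br | tmp | f | out
  deriving DecidableEq, Fintype

/-- All registers: the bookkeeping registers and the register banks of the two embedded
programs (step machine of the reduction, decider of `Q₂`). [folklore] -/
abbrev Ix (n₁ n₂ : ℕ) : Type := Rg ⊕ (Reg n₁ ⊕ Reg n₂)

/-- Programs of the simulation. [folklore] -/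
abbrev Prog (n₁ n₂ : ℕ) : Type := ACom Bool (Ix n₁ n₂)

/-- Stores of the simulation. [folklore] -/
abbrev Store (n₁ n₂ : ℕ) : Type := AStore Bool (Ix n₁ n₂)

/-- The bookkeeping part of a store with prescribed contents. [folklore] -/
def mkR (xr kr br tmp f out : List Bool) : AStore Bool Rg
  | .xr => xr
  | .kr => kr
  | .br => br
  | .tmp => tmp
  | .f => f
  | .out => out

variable {n₁ n₂ : ℕ}

/-- The store with prescribed bookkeeping registers and prescribed banks. [folklore] -/
def st (xr kr br tmp f out : List Bool) (b₁ : AStore Bool (Reg n₁)) (b₂ : AStore Bool (Reg n₂)) :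
    Store n₁ n₂ :=
  Sum.elim (mkR xr kr br tmp f out) (Sum.elim b₁ b₂)

/-- Register `xr` inside `Ix`. [folklore] -/
abbrev XR : Ix n₁ n₂ := Sum.inl Rg.xr
/-- Register `kr` inside `Ix`. [folklore] -/
abbrev KR : Ix n₁ n₂ := Sum.inl Rg.kr
/-- Register `br` inside `Ix`. [folklore] -/
abbrev BR : Ix n₁ n₂ := Sum.inl Rg.br
/-- Register `tmp` inside `Ix`. [folklore] -/
abbrev TMP : Ix n₁ n₂ := Sum.inl Rg.tmp
/-- Register `f` inside `Ix`. [folklore] -/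
abbrev FL : Ix n₁ n₂ := Sum.inl Rg.f
/-- Register `out` inside `Ix`. [folklore] -/
abbrev OUT : Ix n₁ n₂ := Sum.inl Rg.out
/-- Stack `k` of the first bank (step machine). [folklore] -/
abbrev rN (k : Fin n₁) : Ix n₁ n₂ := Sum.inr (Sum.inl (Reg.stk k))
/-- Stack `k` of the second bank (decider of `Q₂`). [folklore] -/
abbrev rS (k : Fin n₂) : Ix n₁ n₂ := Sum.inr (Sum.inr (Reg.stk k))

/-- The empty bank. [folklore] -/
abbrev emp {ι : Type} : AStore Bool ι := fun _ => []

section StLemmas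

variable (xr kr br tmp f out v : List Bool) (b₁ : AStore Bool (Reg n₁)) (b₂ : AStore Bool (Reg n₂))

/-- Read-out of `xr`. [folklore] -/
@[simp] theorem st_xr : st xr kr br tmp f out b₁ b₂ XR = xr := rfl
/-- Read-out of `kr`. [folklore] -/
@[simp] theorem st_kr : st xr kr br tmp f out b₁ b₂ KR = kr := rfl
/-- Read-out of `br`. [folklore] -/
@[simp] theorem st_br : st xr kr br tmp f out b₁ b₂ BR = br := rfl
/-- Read-out of `tmp`. [folklore] -/
@[simp] theorem st_tmp : st xr kr br tmp f out b₁ b₂ TMP = tmp := rfl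
/-- Read-out of `f`. [folklore] -/
@[simp] theorem st_f : st xr kr br tmp f out b₁ b₂ FL = f := rfl
/-- Read-out of `out`. [folklore] -/
@[simp] theorem st_out : st xr kr br tmp f out b₁ b₂ OUT = out := rfl
/-- Read-out of the first bank. [folklore] -/
@[simp] theorem st_inr_inl (r : Reg n₁) : st xr kr br tmp f out b₁ b₂ (Sum.inr (Sum.inl r)) = b₁ r :=
  rfl
/-- Read-out of the second bank. [folklore] -/
@[simp] theorem st_inr_inr (r : Reg n₂) : st xr kr br tmp f out b₁ b₂ (Sum.inr (Sum.inr r)) = b₂ r :=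
  rfl

/-- Update of `xr`. [folklore] -/
@[simp] theorem update_st_xr :
    Function.update (st xr kr br tmp f out b₁ b₂) XR v = st v kr br tmp f out b₁ b₂ := by
  unfold st XR; rw [Sum.update_elim_inl]; congr 1; funext r; cases r <;> rfl
/-- Update of `kr`. [folklore] -/
@[simp] theorem update_st_kr :
    Function.update (st xr kr br tmp f out b₁ b₂) KR v = st xr v br tmp f out b₁ b₂ := by
  unfold st KR; rw [Sum.update_elim_inl]; congr 1; funext r; cases r <;> rfl
/-- Update of `br`. [folklore] -/
@[simp] theorem update_st_br :
    Function.update (st xr kr br tmp f out b₁ b₂) BR v = st xr kr v tmp f out b₁ b₂ := by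
  unfold st BR; rw [Sum.update_elim_inl]; congr 1; funext r; cases r <;> rfl
/-- Update of `tmp`. [folklore] -/
@[simp] theorem update_st_tmp :
    Function.update (st xr kr br tmp f out b₁ b₂) TMP v = st xr kr br v f out b₁ b₂ := by
  unfold st TMP; rw [Sum.update_elim_inl]; congr 1; funext r; cases r <;> rfl
/-- Update of `f`. [folklore] -/
@[simp] theorem update_st_f :
    Function.update (st xr kr br tmp f out b₁ b₂) FL v = st xr kr br tmp v out b₁ b₂ := by
  unfold st FL; rw [Sum.update_elim_inl]; congr 1; funext r; cases r <;> rfl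
/-- Update of `out`. [folklore] -/
@[simp] theorem update_st_out :
    Function.update (st xr kr br tmp f out b₁ b₂) OUT v = st xr kr br tmp f v b₁ b₂ := by
  unfold st OUT; rw [Sum.update_elim_inl]; congr 1; funext r; cases r <;> rfl
/-- Update of the first bank. [folklore] -/
@[simp] theorem update_st_inr_inl (r : Reg n₁) :
    Function.update (st xr kr br tmp f out b₁ b₂) (Sum.inr (Sum.inl r)) v =
      st xr kr br tmp f out (Function.update b₁ r v) b₂ := by
  unfold st; rw [Sum.update_elim_inr, Sum.update_elim_inl]
/-- Update of the second bank. [folklore] -/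
@[simp] theorem update_st_inr_inr (r : Reg n₂) :
    Function.update (st xr kr br tmp f out b₁ b₂) (Sum.inr (Sum.inr r)) v =
      st xr kr br tmp f out b₁ (Function.update b₂ r v) := by
  unfold st; rw [Sum.update_elim_inr, Sum.update_elim_inr]

end StLemmas

/-- Banks in normal form: updating the empty bank gives a `single`. [folklore] -/
@[simp] theorem update_emp {ι : Type} [DecidableEq ι] (r : ι) (w : List Bool) :
    Function.update (emp : AStore Bool ι) r w = AStore.single r w :=
  (AStore.single_eq_update r w).symm

/-- Banks in normal form: updating a `single` at its register. [folklore] -/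
@[simp] theorem update_single {ι : Type} [DecidableEq ι] (r : ι) (w w' : List Bool) :
    Function.update (AStore.single r w) r w' = AStore.single r w' := by
  rw [AStore.single_eq_update, AStore.single_eq_update, Function.update_idem]

/-- Banks in normal form: a `single` holding the empty word is the empty bank. [folklore] -/
@[simp] theorem single_nil {ι : Type} [DecidableEq ι] (r : ι) :
    AStore.single r ([] : List Bool) = emp := by
  funext i; by_cases h : i = r
  · subst h; simp
  · simp [AStore.single_of_ne h]

/-- The initial store of the compiled machine (input on `tmp`). [folklore] -/
theorem single_TMP (x : List Bool) :
    AStore.single (TMP : Ix n₁ n₂) x = st [] [] [] x [] [] emp emp := by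
  funext i; rcases i with (_ | _ | _ | _ | _ | _) | j | j <;> rfl

/-- The final store of the compiled machine (output on `out`). [folklore] -/
theorem single_OUT (w : List Bool) :
    AStore.single (OUT : Ix n₁ n₂) w = st [] [] [] [] [] w emp emp := by
  funext i; rcases i with (_ | _ | _ | _ | _ | _) | j | j <;> rfl

/-! ### Word formats -/

/-- Every bit doubled (the first field of `boolPair`). Twin of `SProg.dbl`
(`StackMachines.lean`) and `LPD.dbl`; kept local so that this file does not import the transducer
toolkit (refactor: a librarian may merge the copies). [folklore] -/
def dbl (x : List Bool) : List Bool := x.flatMap fun b => [b, b]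

/-- The body of the `listBool` code of a transcript of one-bit answers `bs`:
`b₁ b₁ 0 1 b₂ b₂ 0 1 …`. [folklore] -/
def body (bs : List Bool) : List Bool := bs.flatMap fun b => [b, b, false, true]

/-- Unary words `1ⁿ`. [folklore] -/
abbrev un (n : ℕ) : List Bool := List.replicate n true

/-- The answer transcript of a language oracle: one-bit answers. [folklore] -/
def answers (bs : List Bool) : List (List Bool) := bs.map fun b => [b]

/-- The input word of the step machine after the answers `bs`:
`dbl x ++ 01 ++ 1^{2k} ++ 01 ++ body bs`. [folklore] -/
def inWord (x bs : List Bool) : List Bool :=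
  dbl x ++ false :: true :: (un (2 * bs.length) ++ false :: true :: body bs)

/-- `boolPair` in terms of `dbl` (twin of `LPD.boolPair_eq`, `ShorFactPost.boolPair_eq_dbl`). [folklore] -/
theorem boolPair_eq (x y : List Bool) : boolPair x y = dbl x ++ false :: true :: y := by
  simp [boolPair, dbl]

/-- `dbl` of a cons (twin of `SProg.dbl_cons`). [folklore] -/
theorem dbl_cons (a : Bool) (x : List Bool) : dbl (a :: x) = a :: a :: dbl x := by
  simp [dbl]

/-- Doubling a unary word. [folklore] -/
theorem dbl_un (k : ℕ) : dbl (un k) = un (2 * k) := by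
  induction k with
  | zero => rfl
  | succ k ih =>
    rw [show 2 * (k + 1) = (2 * k + 1) + 1 by ring]
    simp only [un, List.replicate_succ, dbl_cons] at ih ⊢
    rw [ih]

/-- Mathlib's unary code is `1ⁿ` (twin of `UnaryClock.unaryEncodeNat_eq_un`). [folklore] -/
theorem unaryEncodeNat_eq (k : ℕ) : unaryEncodeNat k = un k := by
  induction k with
  | zero => rfl
  | succ k ih => simp [unaryEncodeNat, ih, un, List.replicate_succ]

/-- The fold in `listBool` on one-bit answers is `body`. [folklore] -/
theorem foldr_answers (bs : List Bool) :
    (answers bs).foldr (fun a acc => boolPair ((encodingList Bool).encode a) acc) [] = body bs := by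
  induction bs with
  | nil => rfl
  | cons b bs ih =>
    simp only [answers, List.map_cons, List.foldr_cons] at ih ⊢
    rw [ih]
    simp [boolPair, body, encodingList]

/-- Length of `answers`. [folklore] -/
@[simp] theorem length_answers (bs : List Bool) : (answers bs).length = bs.length := by
  simp [answers]

/-- The `listBool` code of a transcript of one-bit answers. [folklore] -/
theorem listBool_answers (bs : List Bool) :
    (encodingList Bool).listBool.encode (answers bs) = boolPair (un bs.length) (body bs) := by
  change boolPair (unaryEncodeNat (answers bs).length)
    ((answers bs).foldr (fun a acc => boolPair ((encodingList Bool).encode a) acc) []) = _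
  rw [foldr_answers, length_answers, unaryEncodeNat_eq]

/-- **The input word of the step machine** is `inWord`. [folklore] -/
theorem inWord_eq (x bs : List Bool) :
    boolPair x ((encodingList Bool).listBool.encode (answers bs)) = inWord x bs := by
  rw [listBool_answers, boolPair_eq, boolPair_eq, dbl_un]
  rfl

/-- Length of `dbl` (twin of `SProg.length_dbl`). [folklore] -/
@[simp] theorem length_dbl (x : List Bool) : (dbl x).length = 2 * x.length := by
  induction x with
  | nil => rfl
  | cons a x ih => rw [dbl_cons]; simp only [List.length_cons, ih]; omega

/-- `body` of a cons. [folklore] -/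
theorem body_cons (b : Bool) (bs : List Bool) : body (b :: bs) = b :: b :: false :: true :: body bs := by
  simp [body]

/-- Length of `body`. [folklore] -/
@[simp] theorem length_body (bs : List Bool) : (body bs).length = 4 * bs.length := by
  induction bs with
  | nil => rfl
  | cons b bs ih => rw [body_cons]; simp only [List.length_cons, ih]; omega

/-- Length of `inWord`. [folklore] -/
@[simp] theorem length_inWord (x bs : List Bool) :
    (inWord x bs).length = 2 * x.length + 6 * bs.length + 4 := by
  simp [inWord]; omega

/-- Length of the transcript code. [folklore] -/
theorem length_listBool_answers (bs : List Bool) :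
    ((encodingList Bool).listBool.encode (answers bs)).length = 6 * bs.length + 2 := by
  have h := congrArg List.length (inWord_eq [] bs)
  simp only [length_boolPair, List.length_nil, length_inWord] at h
  omega

/-- Appending an answer appends a block to the body. [folklore] -/
theorem body_append_singleton (bs : List Bool) (b : Bool) :
    body (bs ++ [b]) = body bs ++ [b, b, false, true] := by
  simp [body, List.flatMap_append]

/-- Appending an answer to the transcript. [folklore] -/
theorem answers_append (bs : List Bool) (b : Bool) :
    answers bs ++ [[b]] = answers (bs ++ [b]) := by
  simp [answers]

/-- The empty body (cf. `OracleCompose.body_nil`, a different `body` with the same shape). [folklore] -/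
@[simp] theorem body_nil : body [] = [] := rfl

/-- `dbl` of the empty word (twin of `SProg.dbl_nil`). [folklore] -/
@[simp] theorem dbl_nil : dbl [] = [] := rfl

/-! ### The programs -/

/-- Embedding of the step-machine program (first bank). [folklore] -/
def embN (PN : TM2Flat.Prog n₁) : Prog n₁ n₂ :=
  (PN.map (Sum.inl : Reg n₁ → Reg n₁ ⊕ Reg n₂)).map Sum.inr

/-- Embedding of the decider program (second bank). [folklore] -/
def embS (P2 : TM2Flat.Prog n₂) : Prog n₁ n₂ :=
  (P2.map (Sum.inr : Reg n₂ → Reg n₁ ⊕ Reg n₂)).map Sum.inr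

/-- **Build the input word of the step machine** on its input stack `k₀`:
body, separator, counter, separator, doubled input (pushed in this order, i.e. bottom-up),
restoring the three bookkeeping registers. [folklore] -/
def buildInput (k₀ : Fin n₁) : Prog n₁ n₂ :=
  copy2 BR (rN k₀) TMP ;; pour TMP BR ;;
  push (rN k₀) true ;; push (rN k₀) false ;;
  copy2 KR (rN k₀) TMP ;; pour TMP KR ;;
  push (rN k₀) true ;; push (rN k₀) false ;;
  loop XR (fun b => push (rN k₀) b ;; push (rN k₀) b ;; push TMP b) ;;
  pour TMP XR

/-- After the decider answered `b` on its output stack `j₁`: append the block `b b 0 1` to the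
body (reversed: push `b, b, 0, 1`), bump the counter by `11`, re-arm the loop flag. [folklore] -/
def afterQuery (j₁ : Fin n₂) : Prog n₁ n₂ :=
  pop (rS j₁) fun o => match o with
    | some b => push BR b ;; push BR b ;; push BR false ;; push BR true ;;
        push KR true ;; push KR true ;; push FL true
    | none => skip

/-- On an output bit `b` (left on the step machine's output stack `k₁`): emit it and clear the
bookkeeping registers; the loop flag stays down. [folklore] -/
def emit (k₁ : Fin n₁) : Prog n₁ n₂ :=
  pop (rN k₁) fun o => match o with
    | some b => push OUT b ;; clear XR ;; clear KR ;; clear BR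
    | none => skip

/-- On a query `q` (left on `k₁`): move it to the decider's input stack `j₀` (two pours keep
the order), run the decider, process its answer. [folklore] -/
def onQuery (k₁ : Fin n₁) (j₀ j₁ : Fin n₂) (P2 : TM2Flat.Prog n₂) : Prog n₁ n₂ :=
  pour (rN k₁) TMP ;; pour TMP (rS j₀) ;; embS P2 ;; afterQuery j₁

/-- Dispatch on the tag bit of the step machine's output (`0` = query, `1` = output). [folklore] -/
def dispatch (k₁ : Fin n₁) (j₀ j₁ : Fin n₂) (P2 : TM2Flat.Prog n₂) : Prog n₁ n₂ :=
  pop (rN k₁) fun o => match o with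
    | some false => onQuery k₁ j₀ j₁ P2
    | some true => emit k₁
    | none => skip

/-- One round of the simulation. [folklore] -/
def simRound (k₀ k₁ : Fin n₁) (j₀ j₁ : Fin n₂) (PN : TM2Flat.Prog n₁) (P2 : TM2Flat.Prog n₂) :
    Prog n₁ n₂ :=
  buildInput k₀ ;; embN PN ;; dispatch k₁ j₀ j₁ P2

/-- **The whole simulation**: reverse the input into `xr`, arm the loop flag, loop. [folklore] -/
def simMain (k₀ k₁ : Fin n₁) (j₀ j₁ : Fin n₂) (PN : TM2Flat.Prog n₁) (P2 : TM2Flat.Prog n₂) :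
    Prog n₁ n₂ :=
  pour TMP XR ;; push FL true ;; loop FL fun _ => simRound k₀ k₁ j₀ j₁ PN P2

/-! ### Runs of the glue programs -/

section Glue

variable (k₀ k₁ : Fin n₁) (j₀ j₁ : Fin n₂)

/-- The embedded step-machine program runs on its bank. [folklore] -/
theorem runs_embN {PN : TM2Flat.Prog n₁} {R R' : AStore Bool (Reg n₁)} {B : ℕ} (h : Runs PN R R' B)
    (xr kr br tmp f out : List Bool) (b₂ : AStore Bool (Reg n₂)) :
    Runs (embN PN : Prog n₁ n₂) (st xr kr br tmp f out R b₂) (st xr kr br tmp f out R' b₂) B :=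
  (h.inl b₂).inr (mkR xr kr br tmp f out)

/-- The embedded decider program runs on its bank. [folklore] -/
theorem runs_embS {P2 : TM2Flat.Prog n₂} {R R' : AStore Bool (Reg n₂)} {B : ℕ} (h : Runs P2 R R' B)
    (xr kr br tmp f out : List Bool) (b₁ : AStore Bool (Reg n₁)) :
    Runs (embS P2 : Prog n₁ n₂) (st xr kr br tmp f out b₁ R) (st xr kr br tmp f out b₁ R') B :=
  (h.inr b₁).inr (mkR xr kr br tmp f out)

/-- Distinctness of bookkeeping registers. [folklore] -/
theorem inl_ne_inl {a b : Rg} (h : a ≠ b) : (Sum.inl a : Ix n₁ n₂) ≠ Sum.inl b :=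
  fun e => h (Sum.inl_injective e)

/-- **Effect and cost of `buildInput`.** [folklore] -/
theorem runs_buildInput (x bs : List Bool) (b₂ : AStore Bool (Reg n₂)) :
    Runs (buildInput k₀ : Prog n₁ n₂)
      (st x.reverse (un (2 * bs.length)) (body bs).reverse [] [] [] emp b₂)
      (st x.reverse (un (2 * bs.length)) (body bs).reverse [] [] []
        (AStore.single (Reg.stk k₀) (inWord x bs)) b₂)
      (42 * bs.length + 8 * x.length + 10) := by
  set K := un (2 * bs.length) with hK
  set W₀ := body bs with hW₀
  set W₁ : List Bool := false :: true :: W₀ with hW₁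
  set W₂ : List Bool := false :: true :: (K ++ W₁) with hW₂
  have hKrev : K.reverse = K := by simp [hK]
  have hKlen : K.length = 2 * bs.length := by simp [hK]
  have hW₀len : W₀.length = 4 * bs.length := by simp [hW₀]
  -- 1. body
  have h1 : Runs (copy2 BR (rN k₀) TMP : Prog n₁ n₂)
      (st x.reverse K W₀.reverse [] [] [] emp b₂)
      (st x.reverse K [] W₀ [] [] (AStore.single (Reg.stk k₀) W₀) b₂) (4 * W₀.reverse.length + 1) := by
    simpa using runs_copy2 (Γ := Bool) (a := (BR : Ix n₁ n₂)) (b := rN k₀) (c := TMP)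
      Sum.inl_ne_inr (inl_ne_inl (by decide)) Sum.inr_ne_inl
      (st x.reverse K W₀.reverse [] [] [] emp b₂)
  have h2 : Runs (pour TMP BR : Prog n₁ n₂)
      (st x.reverse K [] W₀ [] [] (AStore.single (Reg.stk k₀) W₀) b₂)
      (st x.reverse K W₀.reverse [] [] [] (AStore.single (Reg.stk k₀) W₀) b₂) (3 * W₀.length + 1) := by
    simpa using runs_pour (Γ := Bool) (a := (TMP : Ix n₁ n₂)) (b := BR) (inl_ne_inl (by decide))
      (st x.reverse K [] W₀ [] [] (AStore.single (Reg.stk k₀) W₀) b₂)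
  -- 2. separator
  have h3a : Runs (push (rN k₀) true : Prog n₁ n₂)
      (st x.reverse K W₀.reverse [] [] [] (AStore.single (Reg.stk k₀) W₀) b₂)
      (st x.reverse K W₀.reverse [] [] [] (AStore.single (Reg.stk k₀) (true :: W₀)) b₂) 1 :=
    Runs.push' (by simp)
  have h3b : Runs (push (rN k₀) false : Prog n₁ n₂)
      (st x.reverse K W₀.reverse [] [] [] (AStore.single (Reg.stk k₀) (true :: W₀)) b₂)
      (st x.reverse K W₀.reverse [] [] [] (AStore.single (Reg.stk k₀) W₁) b₂) 1 :=
    Runs.push' (by simp [hW₁])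
  -- 3. counter
  have h4 : Runs (copy2 KR (rN k₀) TMP : Prog n₁ n₂)
      (st x.reverse K W₀.reverse [] [] [] (AStore.single (Reg.stk k₀) W₁) b₂)
      (st x.reverse [] W₀.reverse K [] [] (AStore.single (Reg.stk k₀) (K ++ W₁)) b₂)
      (4 * K.length + 1) := by
    simpa [hKrev] using runs_copy2 (Γ := Bool) (a := (KR : Ix n₁ n₂)) (b := rN k₀) (c := TMP)
      Sum.inl_ne_inr (inl_ne_inl (by decide)) Sum.inr_ne_inl
      (st x.reverse K W₀.reverse [] [] [] (AStore.single (Reg.stk k₀) W₁) b₂)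
  have h5 : Runs (pour TMP KR : Prog n₁ n₂)
      (st x.reverse [] W₀.reverse K [] [] (AStore.single (Reg.stk k₀) (K ++ W₁)) b₂)
      (st x.reverse K W₀.reverse [] [] [] (AStore.single (Reg.stk k₀) (K ++ W₁)) b₂)
      (3 * K.length + 1) := by
    simpa [hKrev] using runs_pour (Γ := Bool) (a := (TMP : Ix n₁ n₂)) (b := KR) (inl_ne_inl (by decide))
      (st x.reverse [] W₀.reverse K [] [] (AStore.single (Reg.stk k₀) (K ++ W₁)) b₂)
  -- 4. separator
  have h6a : Runs (push (rN k₀) true : Prog n₁ n₂)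
      (st x.reverse K W₀.reverse [] [] [] (AStore.single (Reg.stk k₀) (K ++ W₁)) b₂)
      (st x.reverse K W₀.reverse [] [] [] (AStore.single (Reg.stk k₀) (true :: (K ++ W₁))) b₂) 1 :=
    Runs.push' (by simp)
  have h6b : Runs (push (rN k₀) false : Prog n₁ n₂)
      (st x.reverse K W₀.reverse [] [] [] (AStore.single (Reg.stk k₀) (true :: (K ++ W₁))) b₂)
      (st x.reverse K W₀.reverse [] [] [] (AStore.single (Reg.stk k₀) W₂) b₂) 1 :=
    Runs.push' (by simp [hW₂])
  -- 5. the doubled input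
  have h7 : Runs (loop XR (fun b => push (rN k₀) b ;; push (rN k₀) b ;; push TMP b) : Prog n₁ n₂)
      (st x.reverse K W₀.reverse [] [] [] (AStore.single (Reg.stk k₀) W₂) b₂)
      (st [] K W₀.reverse x [] [] (AStore.single (Reg.stk k₀) (dbl x ++ W₂)) b₂)
      ((3 + 2) * x.reverse.length + 1) := by
    have h := runs_loop_inv (k := (XR : Ix n₁ n₂))
      (f := fun b => push (rN k₀) b ;; push (rN k₀) b ;; push TMP b)
      (fun done rest => st rest K W₀.reverse done [] [] (AStore.single (Reg.stk k₀) (dbl done ++ W₂)) b₂)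
      (fun _ _ => True) 3
      (fun _ _ _ => rfl)
      (fun done a rest _ => ⟨trivial, by
        refine Runs.of_eq (B := 3) ((Runs.push' rfl).seq ((Runs.push' rfl).seq (Runs.push' rfl))) ?_
          (by norm_num)
        simp [dbl_cons]⟩)
      x.reverse [] trivial
    simpa using h
  have h8 : Runs (pour TMP XR : Prog n₁ n₂)
      (st [] K W₀.reverse x [] [] (AStore.single (Reg.stk k₀) (dbl x ++ W₂)) b₂)
      (st x.reverse K W₀.reverse [] [] [] (AStore.single (Reg.stk k₀) (dbl x ++ W₂)) b₂)
      (3 * x.length + 1) := by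
    simpa using runs_pour (Γ := Bool) (a := (TMP : Ix n₁ n₂)) (b := XR) (inl_ne_inl (by decide))
      (st [] K W₀.reverse x [] [] (AStore.single (Reg.stk k₀) (dbl x ++ W₂)) b₂)
  have hin : dbl x ++ W₂ = inWord x bs := by simp [hW₂, hW₁, hW₀, hK, inWord]
  rw [hin] at h8
  unfold buildInput
  refine (h1.seq (h2.seq (h3a.seq (h3b.seq (h4.seq (h5.seq (h6a.seq (h6b.seq (h7.seq h8))))))))).of_eq
    rfl ?_
  simp only [List.length_reverse, hKlen, hW₀len]
  omega

/-- **Effect and cost of `afterQuery`.** [folklore] -/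
theorem runs_afterQuery (xr kr br : List Bool) (b : Bool) (b₁ : AStore Bool (Reg n₁)) :
    Runs (afterQuery j₁ : Prog n₁ n₂)
      (st xr kr br [] [] [] b₁ (AStore.single (Reg.stk j₁) [b]))
      (st xr (true :: true :: kr) (true :: false :: b :: b :: br) [] [true] [] b₁ emp) (7 + 2) := by
  unfold afterQuery
  refine Runs.pop_cons (B := 7) (a := b) (w := []) (by simp) ?_
  refine Runs.of_eq (B := 7) ((Runs.push' rfl).seq ((Runs.push' rfl).seq ((Runs.push' rfl).seq
    ((Runs.push' rfl).seq ((Runs.push' rfl).seq ((Runs.push' rfl).seq (Runs.push' rfl))))))) ?_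
    (by norm_num)
  simp

/-- **Effect and cost of `emit`.** [folklore] -/
theorem runs_emit (xr kr br : List Bool) (b : Bool) (b₂ : AStore Bool (Reg n₂)) :
    Runs (emit k₁ : Prog n₁ n₂)
      (st xr kr br [] [] [] (AStore.single (Reg.stk k₁) [b]) b₂)
      (st [] [] [] [] [] [b] emp b₂) (2 * xr.length + 2 * kr.length + 2 * br.length + 6) := by
  unfold emit
  refine Runs.pop_cons (B := 2 * xr.length + 2 * kr.length + 2 * br.length + 4) (a := b) (w := [])
    (by simp) ?_
  have h1 : Runs (push OUT b : Prog n₁ n₂) (st xr kr br [] [] [] emp b₂) (st xr kr br [] [] [b] emp b₂) 1 :=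
    Runs.push' (by simp)
  have h2 : Runs (clear XR : Prog n₁ n₂) (st xr kr br [] [] [b] emp b₂) (st [] kr br [] [] [b] emp b₂)
      (2 * xr.length + 1) := by
    simpa using runs_clear (Γ := Bool) (XR : Ix n₁ n₂) (st xr kr br [] [] [b] emp b₂)
  have h3 : Runs (clear KR : Prog n₁ n₂) (st [] kr br [] [] [b] emp b₂) (st [] [] br [] [] [b] emp b₂)
      (2 * kr.length + 1) := by
    simpa using runs_clear (Γ := Bool) (KR : Ix n₁ n₂) (st [] kr br [] [] [b] emp b₂)
  have h4 : Runs (clear BR : Prog n₁ n₂) (st [] [] br [] [] [b] emp b₂) (st [] [] [] [] [] [b] emp b₂)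
      (2 * br.length + 1) := by
    simpa using runs_clear (Γ := Bool) (BR : Ix n₁ n₂) (st [] [] br [] [] [b] emp b₂)
  have := h1.seq (h2.seq (h3.seq h4))
  simp only [update_st_inr_inl, update_single, single_nil] at this ⊢
  exact this.of_eq rfl (by omega)

variable {P2 : TM2Flat.Prog n₂} (ans : List Bool → Bool) (cost₂ : List Bool → ℕ)

/-- **Effect and cost of `onQuery`**, given the behaviour of the decider program. [folklore] -/
theorem runs_onQuery
    (hP2 : ∀ q, Runs P2 (AStore.single (Reg.stk j₀) q) (AStore.single (Reg.stk j₁) [ans q]) (cost₂ q))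
    (xr kr br q : List Bool) :
    Runs (onQuery k₁ j₀ j₁ P2 : Prog n₁ n₂)
      (st xr kr br [] [] [] (AStore.single (Reg.stk k₁) q) emp)
      (st xr (true :: true :: kr) (true :: false :: ans q :: ans q :: br) [] [true] [] emp emp)
      (6 * q.length + cost₂ q + 11) := by
  have h1 : Runs (pour (rN k₁) TMP : Prog n₁ n₂) (st xr kr br [] [] [] (AStore.single (Reg.stk k₁) q) emp)
      (st xr kr br q.reverse [] [] emp emp) (3 * q.length + 1) := by
    simpa using runs_pour (Γ := Bool) (a := (rN k₁ : Ix n₁ n₂)) (b := TMP) Sum.inr_ne_inl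
      (st xr kr br [] [] [] (AStore.single (Reg.stk k₁) q) emp)
  have h2 : Runs (pour TMP (rS j₀) : Prog n₁ n₂) (st xr kr br q.reverse [] [] emp emp)
      (st xr kr br [] [] [] emp (AStore.single (Reg.stk j₀) q)) (3 * q.reverse.length + 1) := by
    simpa using runs_pour (Γ := Bool) (a := (TMP : Ix n₁ n₂)) (b := rS j₀) Sum.inl_ne_inr
      (st xr kr br q.reverse [] [] emp emp)
  have h3 := runs_embS (n₁ := n₁) (hP2 q) xr kr br [] [] [] emp
  have h4 := runs_afterQuery (n₁ := n₁) j₁ xr kr br (ans q) emp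
  unfold onQuery
  refine (h1.seq (h2.seq (h3.seq h4))).of_eq rfl ?_
  simp only [List.length_reverse]
  omega

/-- **`dispatch` on a query.** [folklore] -/
theorem runs_dispatch_query
    (hP2 : ∀ q, Runs P2 (AStore.single (Reg.stk j₀) q) (AStore.single (Reg.stk j₁) [ans q]) (cost₂ q))
    (xr kr br q : List Bool) :
    Runs (dispatch k₁ j₀ j₁ P2 : Prog n₁ n₂)
      (st xr kr br [] [] [] (AStore.single (Reg.stk k₁) (false :: q)) emp)
      (st xr (true :: true :: kr) (true :: false :: ans q :: ans q :: br) [] [true] [] emp emp)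
      (6 * q.length + cost₂ q + 13) := by
  unfold dispatch
  refine Runs.pop_cons (a := false) (w := q) (by simp) ?_
  simpa using runs_onQuery k₁ j₀ j₁ ans cost₂ hP2 xr kr br q

/-- **`dispatch` on an output.** [folklore] -/
theorem runs_dispatch_output (P2 : TM2Flat.Prog n₂) (xr kr br : List Bool) (b : Bool) :
    Runs (dispatch k₁ j₀ j₁ P2 : Prog n₁ n₂)
      (st xr kr br [] [] [] (AStore.single (Reg.stk k₁) [true, b]) emp)
      (st [] [] [] [] [] [b] emp emp) (2 * xr.length + 2 * kr.length + 2 * br.length + 8) := by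
  unfold dispatch
  refine Runs.pop_cons (a := true) (w := [b]) (by simp) ?_
  simpa using runs_emit k₁ xr kr br b emp

end Glue

/-! ### Rounds and the main loop against the oracle algorithm -/

/-- Mathlib's `encodeBool b` is the one-bit word `[b]` (twin of `Lemma3FP.encodeBool_eq`). [folklore] -/
theorem encodeBool_eq (b : Bool) : encodeBool b = [b] := rfl

/-- Bumping the unary counter. [folklore] -/
theorem un_two_mul_succ (k : ℕ) : un (2 * (k + 1)) = true :: true :: un (2 * k) := by
  rw [show 2 * (k + 1) = (2 * k + 1) + 1 by ring]
  simp [un, List.replicate_succ]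

/-- Appending an answer to the reversed body. [folklore] -/
theorem reverse_body_append (bs : List Bool) (a : Bool) :
    (body (bs ++ [a])).reverse = true :: false :: a :: a :: (body bs).reverse := by
  rw [body_append_singleton, List.reverse_append]
  rfl

section Loop

variable (k₀ k₁ : Fin n₁) (j₀ j₁ : Fin n₂) {PN : TM2Flat.Prog n₁} {P2 : TM2Flat.Prog n₂}
  (M : OracleAlg Bool) (L₂ : Language Bool) (x : List Bool)
  (costN : List Bool → ℕ) (cost₂ : List Bool → ℕ)

/-- The store at the start of a round (flag `fl`): reversed input, counter, reversed body,
everything else empty. [folklore] -/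
def S (x bs fl : List Bool) : Store n₁ n₂ :=
  st x.reverse (un (2 * bs.length)) (body bs).reverse [] fl [] emp emp

/-- The specification of the step-machine program: on the input word after the answers `bs`
it leaves the tagged code of `M.step x (answers bs)` on its output stack. [folklore] -/
def StepSpec (k₀ k₁ : Fin n₁) (PN : TM2Flat.Prog n₁) (M : OracleAlg Bool) (x : List Bool)
    (costN : List Bool → ℕ) : Prop :=
  ∀ bs, Runs PN (AStore.single (Reg.stk k₀) (inWord x bs))
    (AStore.single (Reg.stk k₁)
      (((encodingList Bool).sumBool encodingBoolBool).encode (M.step x (answers bs)))) (costN bs)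

/-- The specification of the decider program: on `q` it leaves the bit `[q ∈ L₂]` on its
output stack. [folklore] -/
def DecSpec (j₀ j₁ : Fin n₂) (P2 : TM2Flat.Prog n₂) (L₂ : Language Bool) (cost₂ : List Bool → ℕ) :
    Prop :=
  ∀ q, Runs P2 (AStore.single (Reg.stk j₀) q) (AStore.single (Reg.stk j₁) [L₂.boolIndicator q])
    (cost₂ q)

variable {k₀ k₁ j₀ j₁ M L₂ x costN cost₂}

/-- **A query round**: from the round store after `bs`, if the step is the query `q`, one round
leads to the round store after `bs ++ [[q ∈ L₂]]` with the flag re-armed. [folklore] -/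
theorem runs_round_query (hPN : StepSpec k₀ k₁ PN M x costN) (hP2 : DecSpec j₀ j₁ P2 L₂ cost₂)
    (bs q : List Bool) (hs : M.step x (answers bs) = Sum.inl q) :
    Runs (simRound k₀ k₁ j₀ j₁ PN P2 : Prog n₁ n₂) (S x bs []) (S x (bs ++ [L₂.boolIndicator q]) [true])
      (42 * bs.length + 8 * x.length + 10 + costN bs + (6 * q.length + cost₂ q + 13)) := by
  have h1 := runs_buildInput (n₁ := n₁) (n₂ := n₂) k₀ x bs emp
  have h2 := runs_embN (n₂ := n₂) (hPN bs) x.reverse (un (2 * bs.length)) (body bs).reverse [] [] [] emp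
  rw [hs] at h2
  have h3 := runs_dispatch_query (n₁ := n₁) k₁ j₀ j₁ (fun q => L₂.boolIndicator q) cost₂ hP2
    x.reverse (un (2 * bs.length)) (body bs).reverse q
  unfold simRound
  refine (h1.seq (h2.seq h3)).of_eq ?_ (by omega)
  simp only [S, List.length_append, List.length_singleton, un_two_mul_succ, reverse_body_append]

/-- **An output round**: if the step is the output `b`, one round leads to the final store.
[folklore] -/
theorem runs_round_output (hPN : StepSpec k₀ k₁ PN M x costN) (P2 : TM2Flat.Prog n₂)
    (bs : List Bool) (b : Bool) (hs : M.step x (answers bs) = Sum.inr b) :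
    Runs (simRound k₀ k₁ j₀ j₁ PN P2 : Prog n₁ n₂) (S x bs []) (st [] [] [] [] [] [b] emp emp)
      (42 * bs.length + 8 * x.length + 10 + costN bs + (2 * x.length + 12 * bs.length + 8)) := by
  have h1 := runs_buildInput (n₁ := n₁) (n₂ := n₂) k₀ x bs emp
  have h2 := runs_embN (n₂ := n₂) (hPN bs) x.reverse (un (2 * bs.length)) (body bs).reverse [] [] [] emp
  rw [hs] at h2
  have h3 := runs_dispatch_output (n₁ := n₁) k₁ j₀ j₁ P2 x.reverse (un (2 * bs.length)) (body bs).reverse b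
  unfold simRound
  refine (h1.seq (h2.seq h3)).of_eq rfl ?_
  simp only [List.length_reverse, List.length_replicate, length_body]
  omega

variable (R BN Lq B₂ : ℕ)

/-- The uniform budget of one query round (including the loop overhead `2`). [folklore] -/
def Wq (x : List Bool) (R BN Lq B₂ : ℕ) : ℕ := 42 * R + 8 * x.length + 10 + BN + (6 * Lq + B₂ + 13) + 2

/-- The budget of the output round (including the loop overhead `2 + 1`). [folklore] -/
def Vout (x : List Bool) (R BN : ℕ) : ℕ := 42 * R + 8 * x.length + 10 + BN + (2 * x.length + 12 * R + 8) + 3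

/-- **The main loop simulates the oracle algorithm.** If from the transcript `answers bs` the
run of `M` with oracle `L₂` outputs `b` within `k` rounds, all queries asked on the way are
short and cheap for the decider, and the step program is cheap on all transcripts of length
`≤ R`, then the loop leads from the round store after `bs` (flag armed) to the final store with
output `[b]` within `k · Wq + Vout`. [folklore] -/
theorem runs_loop (hPN : StepSpec k₀ k₁ PN M x costN) (hP2 : DecSpec j₀ j₁ P2 L₂ cost₂)
    (hBN : ∀ bs, bs.length ≤ R → costN bs ≤ BN) :
    ∀ (k : ℕ) (bs : List Bool) (b : Bool),
      M.runAux (Oracle.ofLanguage L₂) x k (answers bs) = some b →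
      (∀ q ∈ M.queriesAux (Oracle.ofLanguage L₂) x k (answers bs), q.length ≤ Lq ∧ cost₂ q ≤ B₂) →
      bs.length + k ≤ R →
      Runs (loop FL fun _ => simRound k₀ k₁ j₀ j₁ PN P2 : Prog n₁ n₂) (S x bs [true])
        (st [] [] [] [] [] [b] emp emp) (k * Wq x R BN Lq B₂ + Vout x R BN)
  | 0, bs, b, hrun, _, _ => by simp at hrun
  | k + 1, bs, b, hrun, hq, hR => by
    rw [OracleAlg.runAux_succ] at hrun
    cases hs : M.step x (answers bs) with
    | inl q =>
      rw [hs] at hrun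
      simp only [Oracle.ofLanguage_apply] at hrun
      have hq' : ∀ q' ∈ q :: M.queriesAux (Oracle.ofLanguage L₂) x k (answers bs ++ [[L₂.boolIndicator q]]),
          q'.length ≤ Lq ∧ cost₂ q' ≤ B₂ := by
        intro q' hq'
        apply hq
        rw [OracleAlg.queriesAux, hs]
        simpa [encodeBool_eq] using hq'
      have hans : answers bs ++ [[L₂.boolIndicator q]] = answers (bs ++ [L₂.boolIndicator q]) :=
        answers_append bs _
      rw [show encodeBool (L₂.boolIndicator q) = [L₂.boolIndicator q] from rfl, hans] at hrun
      rw [hans] at hq'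
      have ih := runs_loop hPN hP2 hBN k (bs ++ [L₂.boolIndicator q]) b hrun
        (fun q' h' => hq' q' (List.mem_cons_of_mem _ h')) (by simp; omega)
      have hb := runs_round_query hPN hP2 bs q hs
      have := Runs.loop_cons (k := (FL : Ix n₁ n₂)) (f := fun _ => simRound k₀ k₁ j₀ j₁ PN P2)
        (R := S x bs [true]) (a := true) (w := []) rfl (by simpa [S] using hb) ih
      refine this.mono ?_
      obtain ⟨hql, hqc⟩ := hq' q (List.mem_cons_self ..)
      have h1 : costN bs ≤ BN := hBN bs (by omega)
      have h2 : 42 * bs.length ≤ 42 * R := by omega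
      simp only [Wq, Nat.succ_mul]
      omega
    | inr b' =>
      rw [hs] at hrun
      simp only [Option.some.injEq] at hrun
      subst hrun
      have hb := runs_round_output (j₀ := j₀) (j₁ := j₁) hPN P2 bs b' hs
      have hnil : Runs (loop FL fun _ => simRound k₀ k₁ j₀ j₁ PN P2 : Prog n₁ n₂)
          (st [] [] [] [] [] [b'] emp emp) (st [] [] [] [] [] [b'] emp emp) 1 :=
        Runs.loop_nil _ rfl
      have := Runs.loop_cons (k := (FL : Ix n₁ n₂)) (f := fun _ => simRound k₀ k₁ j₀ j₁ PN P2)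
        (R := S x bs [true]) (a := true) (w := []) rfl (by simpa [S] using hb) hnil
      refine this.mono ?_
      have h1 : costN bs ≤ BN := hBN bs (by omega)
      simp only [Vout]
      nlinarith [Nat.zero_le (k * Wq x R BN Lq B₂), Nat.zero_le (Wq x R BN Lq B₂)]

/-- **The whole simulation program is correct**, with the budget
`3|x| + 2 + R · Wq + Vout`. [folklore] -/
theorem runs_simMain (hPN : StepSpec k₀ k₁ PN M x costN) (hP2 : DecSpec j₀ j₁ P2 L₂ cost₂)
    (hBN : ∀ bs, bs.length ≤ R → costN bs ≤ BN) {b : Bool}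
    (hrun : M.run (Oracle.ofLanguage L₂) R x = some b)
    (hq : ∀ q ∈ M.queries (Oracle.ofLanguage L₂) R x, q.length ≤ Lq ∧ cost₂ q ≤ B₂) :
    Runs (simMain k₀ k₁ j₀ j₁ PN P2 : Prog n₁ n₂) (AStore.single TMP x) (AStore.single OUT [b])
      (3 * x.length + 2 + (R * Wq x R BN Lq B₂ + Vout x R BN)) := by
  have h1 : Runs (pour TMP XR : Prog n₁ n₂) (st [] [] [] x [] [] emp emp) (st x.reverse [] [] [] [] [] emp emp)
      (3 * x.length + 1) := by
    simpa using runs_pour (Γ := Bool) (a := (TMP : Ix n₁ n₂)) (b := XR) (inl_ne_inl (by decide))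
      (st [] [] [] x [] [] emp emp)
  have h2 : Runs (push FL true : Prog n₁ n₂) (st x.reverse [] [] [] [] [] emp emp) (S x [] [true]) 1 :=
    Runs.push' (by simp [S])
  have h3 := runs_loop R BN Lq B₂ hPN hP2 hBN R [] b hrun hq (by simp)
  rw [single_TMP, single_OUT]
  unfold simMain
  exact (h1.seq (h2.seq h3)).of_eq rfl (by omega)

end Loop

/-! ### Arithmetic of the total budget -/

/-- **The total budget is a product of three small factors**: with
`S = Bst + BT + Lq + n + R + 1` dominating every atom, the budget of `runs_simMain` (plus the
final `+ 1` of the compiled machine) is at most `A · (R + 1) · S` for the constant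
`A = 91 + eN (D + 26) + 4 e₂`. [folklore] -/
theorem total_le (eN e₂ D R Bst BT Lq : ℕ) (x : List Bool) :
    3 * x.length + 2 +
        (R * Wq x R (eN * ((D + 1) * Bst + 2 * (2 * x.length + 6 * R + 4)) + eN) Lq
            (e₂ * (BT + Lq + 1) + e₂) +
          Vout x R (eN * ((D + 1) * Bst + 2 * (2 * x.length + 6 * R + 4)) + eN)) + 1 ≤
      (91 + eN * (D + 26) + 4 * e₂) * ((R + 1) * (Bst + BT + Lq + x.length + R + 1)) := by
  set n := x.length with hn
  set S := Bst + BT + Lq + n + R + 1 with hS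
  set BN := eN * ((D + 1) * Bst + 2 * (2 * n + 6 * R + 4)) + eN with hBN
  set B₂ := e₂ * (BT + Lq + 1) + e₂ with hB₂
  have hBN' : BN ≤ eN * ((D + 26) * S) := by
    have h1 : (D + 1) * Bst ≤ (D + 1) * S := Nat.mul_le_mul_left _ (by omega)
    have h2 : (D + 1) * Bst + 2 * (2 * n + 6 * R + 4) + 1 ≤ (D + 26) * S := by
      have : (D + 26) * S = (D + 1) * S + 25 * S := by ring
      omega
    calc BN = eN * ((D + 1) * Bst + 2 * (2 * n + 6 * R + 4) + 1) := by rw [hBN]; ring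
      _ ≤ eN * ((D + 26) * S) := Nat.mul_le_mul_left _ h2
  have hB₂' : B₂ ≤ e₂ * (4 * S) := by
    calc B₂ = e₂ * (BT + Lq + 1 + 1) := by rw [hB₂]; ring
      _ ≤ e₂ * (4 * S) := Nat.mul_le_mul_left _ (by omega)
  have hA₁S : (85 + eN * (D + 26) + 4 * e₂) * S = 85 * S + eN * ((D + 26) * S) + e₂ * (4 * S) := by
    ring
  have hW : Wq x R BN Lq B₂ ≤ (85 + eN * (D + 26) + 4 * e₂) * S := by
    rw [hA₁S]; unfold Wq; omega
  have hV : Vout x R BN ≤ (85 + eN * (D + 26) + 4 * e₂) * S := by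
    rw [hA₁S]; unfold Vout; omega
  set A₁ := 85 + eN * (D + 26) + 4 * e₂ with hA₁
  calc 3 * n + 2 + (R * Wq x R BN Lq B₂ + Vout x R BN) + 1
      ≤ 6 * S + (R * (A₁ * S) + A₁ * S) := by
        have : R * Wq x R BN Lq B₂ ≤ R * (A₁ * S) := Nat.mul_le_mul_left _ hW
        omega
    _ ≤ 6 * S + (R * (A₁ * S) + A₁ * S) + 6 * (R * S) := Nat.le_add_right _ _
    _ = (91 + eN * (D + 26) + 4 * e₂) * ((R + 1) * S) := by rw [hA₁]; ring

/-! ### Bounds of the form `c · 2^{κ p(x)} · (|x|+1)^c` -/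

/-- `Gb κ p f`: the real-valued `f` is bounded by `c · 2^{κ p(x)} · (|x|+1)^c` for some
natural constant `c` (the shape of `IsSubexpTimeBound`). [folklore] -/
def Gb (κ : ℝ) (p : List Bool → ℕ) (f : List Bool → ℝ) : Prop :=
  ∃ c : ℕ, ∀ x : List Bool, f x ≤ c * (2 : ℝ) ^ (κ * p x) * ((x.length : ℝ) + 1) ^ c

namespace Gb

variable {κ κ' κ₁ κ₂ : ℝ} {p : List Bool → ℕ} {f g : List Bool → ℝ}

/-- The exponential factor is at least `1` for nonnegative exponents. [folklore] -/
theorem one_le_two_rpow {κ : ℝ} (hκ : 0 ≤ κ) (p : List Bool → ℕ) (x : List Bool) :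
    (1 : ℝ) ≤ (2 : ℝ) ^ (κ * p x) :=
  Real.one_le_rpow one_le_two (mul_nonneg hκ (Nat.cast_nonneg _))

/-- Comparison. [folklore] -/
theorem of_le (h : Gb κ p g) (hfg : ∀ x, f x ≤ g x) : Gb κ p f := by
  obtain ⟨c, hc⟩ := h
  exact ⟨c, fun x => (hfg x).trans (hc x)⟩

/-- Monotonicity in the exponent. [folklore] -/
theorem mono (h : Gb κ p f) (hκ : κ ≤ κ') : Gb κ' p f := by
  obtain ⟨c, hc⟩ := h
  refine ⟨c, fun x => (hc x).trans ?_⟩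
  have h2 : (2 : ℝ) ^ (κ * p x) ≤ (2 : ℝ) ^ (κ' * p x) :=
    Real.rpow_le_rpow_of_exponent_le one_le_two
      (mul_le_mul_of_nonneg_right hκ (Nat.cast_nonneg _))
  exact mul_le_mul_of_nonneg_right (mul_le_mul_of_nonneg_left h2 (Nat.cast_nonneg c))
    (by positivity)

/-- Sums. [folklore] -/
theorem add (hf : Gb κ p f) (hg : Gb κ p g) : Gb κ p fun x => f x + g x := by
  obtain ⟨c, hc⟩ := hf
  obtain ⟨d, hd⟩ := hg
  refine ⟨c + d, fun x => ?_⟩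
  have hP : (1 : ℝ) ≤ (x.length : ℝ) + 1 := by simp
  have hE : (0 : ℝ) ≤ (2 : ℝ) ^ (κ * p x) := by positivity
  have h1 : ((x.length : ℝ) + 1) ^ c ≤ ((x.length : ℝ) + 1) ^ (c + d) :=
    pow_le_pow_right₀ hP (Nat.le_add_right c d)
  have h2 : ((x.length : ℝ) + 1) ^ d ≤ ((x.length : ℝ) + 1) ^ (c + d) :=
    pow_le_pow_right₀ hP (Nat.le_add_left d c)
  calc f x + g x ≤ c * (2 : ℝ) ^ (κ * p x) * ((x.length : ℝ) + 1) ^ c +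
        d * (2 : ℝ) ^ (κ * p x) * ((x.length : ℝ) + 1) ^ d := add_le_add (hc x) (hd x)
    _ ≤ c * (2 : ℝ) ^ (κ * p x) * ((x.length : ℝ) + 1) ^ (c + d) +
        d * (2 : ℝ) ^ (κ * p x) * ((x.length : ℝ) + 1) ^ (c + d) := by gcongr
    _ = ((c + d : ℕ) : ℝ) * (2 : ℝ) ^ (κ * p x) * ((x.length : ℝ) + 1) ^ (c + d) := by
        push_cast; ring

/-- Products (with nonnegative factors). [folklore] -/
theorem mul (hf : Gb κ₁ p f) (hg : Gb κ₂ p g) (hg0 : ∀ x, 0 ≤ g x) :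
    Gb (κ₁ + κ₂) p fun x => f x * g x := by
  obtain ⟨c, hc⟩ := hf
  obtain ⟨d, hd⟩ := hg
  refine ⟨c * d + (c + d), fun x => ?_⟩
  have hP : (1 : ℝ) ≤ (x.length : ℝ) + 1 := by simp
  have hA : (0 : ℝ) ≤ c * (2 : ℝ) ^ (κ₁ * p x) * ((x.length : ℝ) + 1) ^ c := by positivity
  have hpow : ((x.length : ℝ) + 1) ^ (c + d) ≤ ((x.length : ℝ) + 1) ^ (c * d + (c + d)) :=
    pow_le_pow_right₀ hP (Nat.le_add_left _ _)
  have hcd : ((c * d : ℕ) : ℝ) ≤ ((c * d + (c + d) : ℕ) : ℝ) := by exact_mod_cast Nat.le_add_right _ _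
  have hexp : (2 : ℝ) ^ (κ₁ * p x) * (2 : ℝ) ^ (κ₂ * p x) = (2 : ℝ) ^ ((κ₁ + κ₂) * p x) := by
    rw [← Real.rpow_add two_pos]; ring_nf
  calc f x * g x ≤ (c * (2 : ℝ) ^ (κ₁ * p x) * ((x.length : ℝ) + 1) ^ c) *
        (d * (2 : ℝ) ^ (κ₂ * p x) * ((x.length : ℝ) + 1) ^ d) :=
        mul_le_mul (hc x) (hd x) (hg0 x) hA
    _ = ((c * d : ℕ) : ℝ) * (2 : ℝ) ^ ((κ₁ + κ₂) * p x) * ((x.length : ℝ) + 1) ^ (c + d) := by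
        rw [← hexp]; push_cast; ring
    _ ≤ ((c * d + (c + d) : ℕ) : ℝ) * (2 : ℝ) ^ ((κ₁ + κ₂) * p x) *
        ((x.length : ℝ) + 1) ^ (c * d + (c + d)) := by gcongr

/-- Natural constants. [folklore] -/
theorem const (m : ℕ) (hκ : 0 ≤ κ) : Gb κ p fun _ => (m : ℝ) := by
  refine ⟨m, fun x => ?_⟩
  have hP : (1 : ℝ) ≤ ((x.length : ℝ) + 1) ^ m := one_le_pow₀ (by simp)
  have hE := one_le_two_rpow hκ p x
  calc (m : ℝ) = m * 1 * 1 := by ring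
    _ ≤ m * (2 : ℝ) ^ (κ * p x) * ((x.length : ℝ) + 1) ^ m := by gcongr

/-- Natural constant multiples. [folklore] -/
theorem const_mul (m : ℕ) (h : Gb κ p f) : Gb κ p fun x => (m : ℝ) * f x := by
  obtain ⟨c, hc⟩ := h
  refine ⟨m * c + c, fun x => ?_⟩
  have hP : (1 : ℝ) ≤ (x.length : ℝ) + 1 := by simp
  calc (m : ℝ) * f x ≤ m * (c * (2 : ℝ) ^ (κ * p x) * ((x.length : ℝ) + 1) ^ c) :=
        mul_le_mul_of_nonneg_left (hc x) (Nat.cast_nonneg m)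
    _ = ((m * c : ℕ) : ℝ) * (2 : ℝ) ^ (κ * p x) * ((x.length : ℝ) + 1) ^ c := by push_cast; ring
    _ ≤ ((m * c + c : ℕ) : ℝ) * (2 : ℝ) ^ (κ * p x) * ((x.length : ℝ) + 1) ^ (m * c + c) := by
        gcongr
        · exact_mod_cast Nat.le_add_right _ _
        · exact Nat.le_add_left _ _

/-- The length (plus one). [folklore] -/
theorem length (hκ : 0 ≤ κ) : Gb κ p fun x => (x.length : ℝ) + 1 := by
  refine ⟨1, fun x => ?_⟩
  have hE := one_le_two_rpow hκ p x
  have hP : (0 : ℝ) ≤ (x.length : ℝ) + 1 := by positivity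
  calc (x.length : ℝ) + 1 = 1 * 1 * ((x.length : ℝ) + 1) ^ (1 : ℕ) := by ring
    _ ≤ (1 : ℕ) * (2 : ℝ) ^ (κ * p x) * ((x.length : ℝ) + 1) ^ (1 : ℕ) := by
        push_cast; gcongr

/-- The exponential itself. [folklore] -/
theorem rpow (κ : ℝ) (p : List Bool → ℕ) : Gb κ p fun x => (2 : ℝ) ^ (κ * p x) := by
  refine ⟨1, fun x => ?_⟩
  have h : (2 : ℝ) ^ (κ * p x) ≤ (2 : ℝ) ^ (κ * p x) * ((x.length : ℝ) + 1) :=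
    le_mul_of_one_le_right (by positivity) (by simp)
  simpa using h

/-- Powers of polynomially bounded functions. [folklore] -/
theorem pow (hf : Gb 0 p f) (hf0 : ∀ x, 0 ≤ f x) : ∀ m : ℕ, Gb 0 p fun x => f x ^ m
  | 0 => by simpa using const (p := p) (κ := 0) 1 le_rfl
  | m + 1 => by
    have h := (pow hf hf0 m).mul hf hf0
    simpa [pow_succ] using h

/-- A subexponential time bound is a `Gb` bound of its cast. [folklore] -/
theorem of_isSubexpTimeBound {T : List Bool → ℕ} (h : IsSubexpTimeBound κ p T) :
    Gb κ p fun x => (T x : ℝ) := h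

/-- A `Gb` bound of the cast of a natural-valued function is a subexponential time bound.
[folklore] -/
theorem isSubexpTimeBound {T : List Bool → ℕ} (h : Gb κ p fun x => (T x : ℝ)) :
    IsSubexpTimeBound κ p T := h

end Gb

/-! ### The uniform bounds of the final accounting -/

/-- The real literal `1`. [folklore] -/
theorem Gb.one {κ : ℝ} {p : List Bool → ℕ} (hκ : 0 ≤ κ) : Gb κ p fun _ => (1 : ℝ) := by
  simpa using Gb.const (p := p) 1 hκ

/-- The query-length bound `C (|x|+1)^C`. [folklore] -/
def lq (C : ℕ) (x : List Bool) : ℕ := C * (x.length + 1) ^ C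

/-- `lq` is polynomially bounded. [folklore] -/
theorem gb_lq (C : ℕ) (p : List Bool → ℕ) : Gb 0 p fun x => (lq C x : ℝ) := by
  have h := Gb.const_mul C (Gb.pow (Gb.length (p := p) le_rfl) (fun x => by positivity) C)
  refine h.of_le fun x => le_of_eq ?_
  simp [lq]

/-- The uniform step-time bound `⌊c 2^{δ p(x)} (|x|+1)^c (6 fuel(x) + 3)⌋`. [folklore] -/
noncomputable def bst (c : ℕ) (δ : ℝ) (p fuel : List Bool → ℕ) (x : List Bool) : ℕ :=
  ⌊(c : ℝ) * (2 : ℝ) ^ (δ * p x) * ((x.length : ℝ) + 1) ^ c * (6 * (fuel x : ℝ) + 3)⌋₊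

/-- `bst` dominates the step time on transcripts of at most `fuel x` one-bit answers. [folklore] -/
theorem le_bst {c : ℕ} {δ : ℝ} {p fuel : List Bool → ℕ} {x : List Bool} {t k : ℕ}
    (h : (t : ℝ) ≤ c * (2 : ℝ) ^ (δ * p x) * ((x.length : ℝ) + 1) ^ c * (((6 * k + 2 : ℕ) : ℝ) + 1))
    (hk : k ≤ fuel x) : t ≤ bst c δ p fuel x := by
  refine Nat.le_floor (h.trans ?_)
  have hF : (0 : ℝ) ≤ c * (2 : ℝ) ^ (δ * p x) * ((x.length : ℝ) + 1) ^ c := by positivity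
  refine mul_le_mul_of_nonneg_left ?_ hF
  have : (k : ℝ) ≤ fuel x := by exact_mod_cast hk
  push_cast
  linarith

/-- `bst` has exponent `2δ`. [folklore] -/
theorem gb_bst (c : ℕ) {δ : ℝ} {p fuel : List Bool → ℕ} (hδ : 0 ≤ δ)
    (hfuel : IsSubexpTimeBound δ p fuel) : Gb (δ + δ) p fun x => (bst c δ p fuel x : ℝ) := by
  have gF : Gb δ p fun x => (c : ℝ) * (2 : ℝ) ^ (δ * p x) * ((x.length : ℝ) + 1) ^ c :=
    ⟨c, fun x => le_rfl⟩
  have gG : Gb δ p fun x => 6 * (fuel x : ℝ) + 3 := by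
    simpa using (Gb.const_mul 6 (Gb.of_isSubexpTimeBound hfuel)).add (Gb.const 3 hδ)
  refine (gF.mul gG fun x => by positivity).of_le fun x => ?_
  exact Nat.floor_le (by positivity)

/-- The uniform decider-time bound `⌊c₂ 2^{δ₂ C p(x)} (lq C x + 1)^{c₂}⌋`. [folklore] -/
noncomputable def bt (c₂ C : ℕ) (δ₂ : ℝ) (p : List Bool → ℕ) (x : List Bool) : ℕ :=
  ⌊(c₂ : ℝ) * (2 : ℝ) ^ (δ₂ * ((C * p x : ℕ) : ℝ)) * ((lq C x : ℝ) + 1) ^ c₂⌋₊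

/-- `bt` dominates the decider time on the queries of the run. [folklore] -/
theorem le_bt {c₂ C : ℕ} {δ₂ : ℝ} {p : List Bool → ℕ} {x : List Bool} {t p₂q ql : ℕ}
    (h : (t : ℝ) ≤ c₂ * (2 : ℝ) ^ (δ₂ * p₂q) * ((ql : ℝ) + 1) ^ c₂) (hp : p₂q ≤ C * p x)
    (hl : ql ≤ lq C x) (hδ₂ : 0 ≤ δ₂) : t ≤ bt c₂ C δ₂ p x := by
  refine Nat.le_floor (h.trans ?_)
  have h1 : (2 : ℝ) ^ (δ₂ * p₂q) ≤ (2 : ℝ) ^ (δ₂ * ((C * p x : ℕ) : ℝ)) :=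
    Real.rpow_le_rpow_of_exponent_le one_le_two
      (mul_le_mul_of_nonneg_left (by exact_mod_cast hp) hδ₂)
  have hl' : (ql : ℝ) ≤ lq C x := by exact_mod_cast hl
  have h2 : ((ql : ℝ) + 1) ^ c₂ ≤ ((lq C x : ℝ) + 1) ^ c₂ :=
    pow_le_pow_left₀ (by positivity) (by linarith) c₂
  have h3 : (0 : ℝ) ≤ ((ql : ℝ) + 1) ^ c₂ := by positivity
  calc (c₂ : ℝ) * (2 : ℝ) ^ (δ₂ * p₂q) * ((ql : ℝ) + 1) ^ c₂
      ≤ (c₂ : ℝ) * (2 : ℝ) ^ (δ₂ * ((C * p x : ℕ) : ℝ)) * ((ql : ℝ) + 1) ^ c₂ :=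
        mul_le_mul_of_nonneg_right (mul_le_mul_of_nonneg_left h1 (Nat.cast_nonneg _)) h3
    _ ≤ (c₂ : ℝ) * (2 : ℝ) ^ (δ₂ * ((C * p x : ℕ) : ℝ)) * ((lq C x : ℝ) + 1) ^ c₂ :=
        mul_le_mul_of_nonneg_left h2 (by positivity)

/-- `bt` has exponent `δ₂ C`. [folklore] -/
theorem gb_bt (c₂ C : ℕ) {δ₂ δ : ℝ} (p : List Bool → ℕ) (h : δ₂ * C ≤ δ) :
    Gb δ p fun x => (bt c₂ C δ₂ p x : ℝ) := by
  have gE : Gb (δ₂ * C) p fun x => (2 : ℝ) ^ (δ₂ * ((C * p x : ℕ) : ℝ)) := by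
    refine (Gb.rpow (δ₂ * C) p).of_le fun x => le_of_eq ?_
    push_cast; ring_nf
  have gP : Gb 0 p fun x => ((lq C x : ℝ) + 1) ^ c₂ :=
    Gb.pow ((gb_lq C p).add (Gb.one le_rfl)) (fun x => by positivity) c₂
  have g := ((Gb.const_mul c₂ gE).mul gP fun x => by positivity).of_le
    (f := fun x => (bt c₂ C δ₂ p x : ℝ)) fun x => Nat.floor_le (by positivity)
  exact g.mono (by linarith)

/-- **The final accounting**: the product bound of `total_le` has exponent `3δ`. [folklore] -/
theorem gb_total (A c c₂ C : ℕ) {δ₂ δ ε : ℝ} {p fuel : List Bool → ℕ} (hδ : 0 ≤ δ)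
    (hε : δ + (δ + δ) ≤ ε) (h₂ : δ₂ * C ≤ δ) (hfuel : IsSubexpTimeBound δ p fuel) :
    Gb ε p fun x => (A : ℝ) * (((fuel x : ℝ) + 1) *
      ((bst c δ p fuel x : ℝ) + bt c₂ C δ₂ p x + lq C x + x.length + fuel x + 1)) := by
  have gR : Gb δ p fun x => (fuel x : ℝ) := Gb.of_isSubexpTimeBound hfuel
  have gR1 : Gb δ p fun x => (fuel x : ℝ) + 1 := gR.add (Gb.one hδ)
  have hδ2 : 0 ≤ δ + δ := by linarith
  have gn : Gb (δ + δ) p fun x => (x.length : ℝ) :=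
    (Gb.length hδ2).of_le fun x => by simp
  have gS : Gb (δ + δ) p fun x =>
      (bst c δ p fuel x : ℝ) + bt c₂ C δ₂ p x + lq C x + x.length + fuel x + 1 :=
    (((((gb_bst c hδ hfuel).add ((gb_bt c₂ C p h₂).mono (by linarith))).add
      ((gb_lq C p).mono hδ2)).add gn).add (gR.mono (by linarith))).add (Gb.one hδ2)
  exact (Gb.const_mul A (gR1.mul gS fun x => by positivity)).mono hε

/-! ### The cost functions of the final assembly -/

/-- The tagged code of the step after the answers `bs`. [folklore] -/
def stepCode (M : OracleAlg Bool) (x bs : List Bool) : List Bool :=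
  ((encodingList Bool).sumBool encodingBoolBool).encode (M.step x (answers bs))

/-- The cost of the step program after the answers `bs` (linear overhead `eN`). [folklore] -/
def costNf (eN : ℕ) (Tstep : List Bool × List (List Bool) → ℕ) (M : OracleAlg Bool)
    (x bs : List Bool) : ℕ :=
  eN * (Tstep (x, answers bs) + (inWord x bs).length + (stepCode M x bs).length) + eN

/-- The cost of the decider program on `q` (linear overhead `e₂`). [folklore] -/
def costDf (e₂ : ℕ) (T₂ : List Bool → ℕ) (q : List Bool) : ℕ := e₂ * (T₂ q + q.length + 1) + e₂

/-- The uniform bound of the step program along the run. [folklore] -/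
noncomputable def BNf (eN D c : ℕ) (δ : ℝ) (p fuel : List Bool → ℕ) (x : List Bool) : ℕ :=
  eN * ((D + 1) * bst c δ p fuel x + 2 * (2 * x.length + 6 * fuel x + 4)) + eN

/-- The uniform bound of the decider program along the run. [folklore] -/
noncomputable def BDf (e₂ c₂ C : ℕ) (δ₂ : ℝ) (p : List Bool → ℕ) (x : List Bool) : ℕ :=
  e₂ * (bt c₂ C δ₂ p x + lq C x + 1) + e₂

/-- The total budget of the simulation program. [folklore] -/
noncomputable def ttot (eN e₂ D c c₂ C : ℕ) (δ δ₂ : ℝ) (p fuel : List Bool → ℕ) (x : List Bool) : ℕ :=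
  3 * x.length + 2 + (fuel x * Wq x (fuel x) (BNf eN D c δ p fuel x) (lq C x) (BDf e₂ c₂ C δ₂ p x) +
    Vout x (fuel x) (BNf eN D c δ p fuel x))

/-- The total budget in product form (`total_le`). [folklore] -/
theorem ttot_succ_le (eN e₂ D c c₂ C : ℕ) (δ δ₂ : ℝ) (p fuel : List Bool → ℕ) (x : List Bool) :
    ttot eN e₂ D c c₂ C δ δ₂ p fuel x + 1 ≤ (91 + eN * (D + 26) + 4 * e₂) *
      ((fuel x + 1) * (bst c δ p fuel x + bt c₂ C δ₂ p x + lq C x + x.length + fuel x + 1)) := by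
  unfold ttot BNf BDf
  exact total_le eN e₂ D (fuel x) (bst c δ p fuel x) (bt c₂ C δ₂ p x) (lq C x) x

/-- **The total budget is subexponential with exponent `ε`** (exponents `ε/3` for the
reduction, `δ₂` with `δ₂ C ≤ ε/3` for the decider). [folklore] -/
theorem isSubexpTimeBound_ttot (eN e₂ D c c₂ C : ℕ) {ε δ₂ : ℝ} (hε : 0 ≤ ε) {p fuel : List Bool → ℕ}
    (hfuel : IsSubexpTimeBound (ε / 3) p fuel) (h₂ : δ₂ * C ≤ ε / 3) :
    IsSubexpTimeBound ε p fun x => ttot eN e₂ D c c₂ C (ε / 3) δ₂ p fuel x + 1 := by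
  have gb := gb_total (91 + eN * (D + 26) + 4 * e₂) c c₂ C (ε := ε) (δ := ε / 3) (δ₂ := δ₂) (p := p)
    (fuel := fuel) (by positivity) (by linarith) h₂ hfuel
  refine Gb.isSubexpTimeBound (gb.of_le fun x => ?_)
  have h' : ((ttot eN e₂ D c c₂ C (ε / 3) δ₂ p fuel x + 1 : ℕ) : ℝ) ≤
      ((91 + eN * (D + 26) + 4 * e₂) * ((fuel x + 1) *
        (bst c (ε / 3) p fuel x + bt c₂ C δ₂ p x + lq C x + x.length + fuel x + 1)) : ℕ) :=
    Nat.cast_le.mpr (ttot_succ_le eN e₂ D c c₂ C (ε / 3) δ₂ p fuel x)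
  refine h'.trans (le_of_eq ?_)
  push_cast
  ring

end SerfSim

/-! ### The theorem -/

open SerfSim Complexity.ACom Complexity.TM2Flat in
/-- **`SE` is closed downwards under SERF reductions** (discharge of
`mem_SE_of_serfReducible`): if `Q₁` SERF-reduces to `Q₂` and `Q₂ ∈ SE` then `Q₁ ∈ SE`.
Given `ε`, the simulation uses the `ε/3`-member of the reduction family (constant `C` on the
parameters of its queries) and an `ε/(3(C+1))`-decider of `Q₂`; it is a while loop over the
transcript model (no clock, no computability of the parameter needed), assembled from the
black-box machines as stack programs (`TM2Flat.exists_runs_of_outputsWithin`,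
`ACom.exists_computesInTime`); total time `poly(|x|) · 2^{(ε/3 + 2ε/3) p₁(x)}`.
[cite: IPZ2001, §2.1 (Lemma: SE is closed under SERF reducibility); FOCS 1998 version
doi:10.1109/sfcs.1998.743516, Lemma 9 (p. 7) with its printed proof] -/
theorem mem_SE_of_serfReducible_holds : mem_SE_of_serfReducible := by
  intro Q₁ Q₂ hred h₂ ε hε
  -- exponents and the data of the hypotheses
  obtain ⟨M, fuel, Tstep, C, hfuel, ⟨N, hN⟩, ⟨c, hc⟩, hrun, hqry⟩ := hred (ε / 3) (by positivity)
  have hδ₂ : (0 : ℝ) < ε / 3 / (C + 1) := by positivity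
  obtain ⟨T₂, M₂, ⟨c₂, hc₂⟩, hM₂⟩ := h₂ (ε / 3 / (C + 1)) hδ₂
  have hCδ : ε / 3 / (C + 1) * C ≤ ε / 3 := by
    rw [div_mul_eq_mul_div, div_le_iff₀ (by positivity)]
    exact mul_le_mul_of_nonneg_left (by linarith) (by positivity)
  -- the two black-box machines as stack programs
  obtain ⟨n₁, PN, k₀, k₁, eN, hPN⟩ := TM2Flat.exists_runs_of_outputsWithin N
  obtain ⟨n₂, P2, j₀, j₁, e₂, hP2⟩ := TM2Flat.exists_runs_of_outputsWithin M₂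
  obtain ⟨D, hD⟩ : ∃ D : ℕ, Complexity.TM2Comp.machinePushBound N.tm = D := ⟨_, rfl⟩
  -- the step machine on the rebuilt input word, the decider on a query
  have hN' : ∀ x bs, N.OutputsWithin (inWord x bs) (stepCode M x bs) (Tstep (x, answers bs)) := by
    intro x bs
    simpa [inWord_eq, stepCode] using hN (x, answers bs)
  have hStep : ∀ x, StepSpec k₀ k₁ PN M x (costNf eN Tstep M x) := fun x bs => hPN _ _ _ (hN' x bs)
  have hDec : DecSpec j₀ j₁ P2 Q₂.lang (costDf e₂ T₂) := by
    intro q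
    simpa [costDf, encodeBool_eq] using hP2 q _ (T₂ q) (hM₂ q)
  -- the uniform bound of the step program along transcripts of length `≤ fuel x`
  have hBNle : ∀ x bs, bs.length ≤ fuel x →
      costNf eN Tstep M x bs ≤ BNf eN D c (ε / 3) Q₁.param fuel x := by
    intro x bs hbs
    have hlen := (hN' x bs).length_le
    rw [hD] at hlen
    have hT : Tstep (x, answers bs) ≤ bst c (ε / 3) Q₁.param fuel x := by
      refine le_bst (k := bs.length) ?_ hbs
      have h1 := hc x (answers bs)
      rwa [length_listBool_answers] at h1
    have hin : (inWord x bs).length = 2 * x.length + 6 * bs.length + 4 := length_inWord x bs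
    have hsum : Tstep (x, answers bs) + (inWord x bs).length + (stepCode M x bs).length ≤
        (D + 1) * bst c (ε / 3) Q₁.param fuel x + 2 * (2 * x.length + 6 * fuel x + 4) := by
      have hDT : D * Tstep (x, answers bs) ≤ D * bst c (ε / 3) Q₁.param fuel x :=
        Nat.mul_le_mul_left _ hT
      have hring : (D + 1) * bst c (ε / 3) Q₁.param fuel x =
          D * bst c (ε / 3) Q₁.param fuel x + bst c (ε / 3) Q₁.param fuel x := by ring
      omega
    unfold costNf BNf
    exact Nat.add_le_add_right (Nat.mul_le_mul_left _ hsum) _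
  -- the queries of the run are short and cheap for the decider
  have hQ : ∀ x, ∀ q ∈ M.queries (Oracle.ofLanguage Q₂.lang) (fuel x) x,
      q.length ≤ lq C x ∧ costDf e₂ T₂ q ≤ BDf e₂ c₂ C (ε / 3 / (C + 1)) Q₁.param x := by
    intro x q hq
    obtain ⟨hpq, hlq⟩ := hqry x q hq
    have hlq' : q.length ≤ lq C x := hlq
    have hT : T₂ q ≤ bt c₂ C (ε / 3 / (C + 1)) Q₁.param x := le_bt (hc₂ q) hpq hlq' hδ₂.le
    refine ⟨hlq', ?_⟩
    unfold costDf BDf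
    exact Nat.add_le_add_right (Nat.mul_le_mul_left _ (by omega)) _
  -- the whole program, and the compiled machine
  have hMain : ∀ x, Runs (simMain k₀ k₁ j₀ j₁ PN P2 : SerfSim.Prog n₁ n₂) (AStore.single TMP x)
      (AStore.single OUT (encodeBool (Q₁.lang.boolIndicator x)))
      (ttot eN e₂ D c c₂ C (ε / 3) (ε / 3 / (C + 1)) Q₁.param fuel x) := fun x =>
    runs_simMain (fuel x) (BNf eN D c (ε / 3) Q₁.param fuel x) (lq C x)
      (BDf e₂ c₂ C (ε / 3 / (C + 1)) Q₁.param x) (hStep x) hDec (hBNle x) (hrun x) (hQ x)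
  obtain ⟨Mach, hMach⟩ := ACom.exists_computesInTime
    (simMain k₀ k₁ j₀ j₁ PN P2 : SerfSim.Prog n₁ n₂) TMP OUT (id : List Bool → List Bool) encodeBool
    Q₁.lang.boolIndicator (ttot eN e₂ D c c₂ C (ε / 3) (ε / 3 / (C + 1)) Q₁.param fuel) hMain
  exact ⟨_, Mach, isSubexpTimeBound_ttot eN e₂ D c c₂ C hε.le hfuel hCδ, hMach⟩

end Literature.Computability.Cryptography
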